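import Literature.Computability.Complexity.TruthTableClosure
import Literature.Computability.Complexity.BPPErrorReduction
import Literature.Computability.Complexity.ArthurMerlinParallelPlay
import HarnessLib

/-!
# Error amplification for `BPP^A`: `BP·(P^A)` with any error `< 1/2` is `BPP^A`

Layer `Literature/Computability/Complexity`, companion of `Oracle.lean` (`BPPRel O = bp (PRel O)`), `BPPErrorReduction.lean`
(the operator `bpErr C e`: witness in `C`, wrong verdict on at most a fraction `e` of the coin
strings; one round of majority-of-three `mem_bpErr_maj3` for `C = P`) and `TruthTableClosure.lean`
(`P^A` contains every polynomial-time truth-table reduction to `A`). The textbook remark "we can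
replace `2/3` with any constant larger than `1/2`" (Arora–Barak 2009, §7.4.1 with Thm. 7.10; it
relativizes: Bennett–Gill 1981, §1) in the direction `error < 1/2 ⟹ error ≤ 1/3`, for the
relativized class:

* `maj3Lang_mem_PRel` — `P^A` is closed under the majority-of-three combination `maj3Lang L' p`
  of `BPPErrorReduction.lean`: it is a three-query truth-table reduction to `L'`
  (`maj3Lang_eq_ttLang`, queries `maj3Qry p`, evaluator `Maj3Dec` — "at least two ones", a
  three-state transducer), hence in `P^{L'}` (`ttLang_mem_PRel`) and in `P^A` for `L' ∈ P^A`
  (`mem_PRel_of_polyTimeTuringReducible_holds`, `P^{P^A} = P^A`);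
* `mem_bpErr_maj3_of` — one round `bpErr C e ⊆ bpErr C (e²(3 − 2e))` for ANY class `C` closed
  under `maj3Lang` (the probability half of `mem_bpErr_maj3` verbatim);
* `bpErr_subset_bp_of_lt_half` — iterating: for `e < 1/2` the error contracts geometrically
  (`maj3Fn_le_mul`: `e²(3 − 2e) ≤ (1 − d) e` when `e ≤ 1/2 − d`, for the tree's one-round map
  `maj3Fn` of `ArthurMerlinParallelPlay.lean`), so finitely many rounds reach `≤ 1/3`, i.e. `bp C`;
* `bpErr_PRel_subset_BPPRel` — **`bpErr (P^A) e ⊆ BPP^A` for every `e < 1/2`**.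

This is the amplification step of the bridge "a PPT oracle adversary deciding `L` with error
bounded away from `1/2` puts `L` in `BPP^A`" (`Cryptography/OracleAdversaryDecider.lean`).

## References

* S. Arora, B. Barak, *Computational Complexity: A Modern Approach*, CUP 2009, §7.4.1 and
  Thm. 7.10 (error reduction by majority vote), §3.4 (oracle machines)
  [AroraBarakCC2009].
* C. H. Bennett, J. Gill, SIAM J. Comput. 10 (1981) 96–113, §1 (relativized probabilistic
  classes) [BennettGill1981].
* R. E. Ladner, N. A. Lynch, A. L. Selman, Theoret. Comput. Sci. 1 (1975), §3 (truth-table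
  reducibility) [LadnerLynchSelman1975].
-/

noncomputable section

namespace Literature.Computability.Complexity

open _root_.Computability Polynomial PRelSigma OracleCompose

/-! ### "At least two ones": a three-state transducer -/

namespace Maj3Amp

/-- Saturating count of ones: none, one, at least two. [folklore] -/
inductive C3
  | zero
  | one
  | two
  deriving DecidableEq, Fintype

/-- One more one (saturating at two). [folklore] -/
def C3.bump : C3 → C3
  | .zero => .one
  | .one => .two
  | .two => .two

/-- The transducer announcing whether at least two ones occur: state = saturated count; it emits
nothing and prepends `[count = two]` (a three-state Moore machine). [folklore] -/
def twoOnesT : FST C3 Bool Bool where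
  init := C3.zero
  step s c := (if c then s.bump else s, [])
  front s := [decide (s = C3.two)]
  keep _ := false

/-- The transition of `twoOnesT` (definitional). [folklore] -/
@[simp] theorem twoOnesT_step (s : C3) (c : Bool) :
    twoOnesT.step s c = (if c then s.bump else s, []) := rfl

/-- The run of `twoOnesT`: the state is bumped once per one. [folklore] -/
theorem twoOnesT_run (s : C3) (w : List Bool) :
    twoOnesT.run s w = (C3.bump^[w.count true] s, []) := by
  induction w generalizing s with
  | nil => simp
  | cons c w ih =>
    rw [FST.run_cons, twoOnesT_step, ih, List.count_cons]
    cases c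
    · simp
    · simp only [if_true, beq_self_eq_true, List.append_nil, Prod.mk.injEq, and_true]
      rw [Function.iterate_succ_apply]

/-- The saturated count is `two` iff at least two ones were counted. [folklore] -/
theorem bump_iterate_zero_eq_two_iff (n : ℕ) : C3.bump^[n] C3.zero = C3.two ↔ 2 ≤ n := by
  rcases n with _ | _ | n
  · simp
  · simp [C3.bump]
  · simp only [le_add_iff_nonneg_left, zero_le, iff_true]
    rw [show n + 1 + 1 = n + 2 from rfl, Function.iterate_add_apply]
    change C3.bump^[n] C3.two = C3.two
    induction n with
    | zero => rfl
    | succ n ih => rw [Function.iterate_succ_apply', ih]; rfl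

/-- **`twoOnesT` decides "at least two ones"**: `twoOnesT w = [decide (2 ≤ count 1 w)]`. [folklore] -/
theorem twoOnesT_eval (w : List Bool) : twoOnesT.eval w = [decide (2 ≤ w.count true)] := by
  rw [FST.eval, show twoOnesT.init = C3.zero from rfl, twoOnesT_run]
  simp [twoOnesT, bump_iterate_zero_eq_two_iff]

/-- The language of strings with at least two ones. [folklore] -/
def AtLeastTwoOnes : Language Bool := {w | 2 ≤ w.count true}

/-- Membership in `AtLeastTwoOnes`. [folklore] -/
@[simp] theorem mem_AtLeastTwoOnes {w : List Bool} : w ∈ AtLeastTwoOnes ↔ 2 ≤ w.count true := Iff.rfl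

/-- `AtLeastTwoOnes ∈ P` (a three-state transducer decides it). [folklore] -/
theorem AtLeastTwoOnes_mem_P : AtLeastTwoOnes ∈ Classes.P :=
  mem_P_of_mem_FP twoOnesT.polyTimeComputable_eval _ fun w =>
    ⟨fun h => by rw [twoOnesT_eval]; simpa using h, fun h => by rw [twoOnesT_eval]; simpa using h⟩

/-- Two out of three decided bits are set iff two of the three propositions hold. [folklore] -/
theorem two_le_count_iff (P Q R : Prop) [Decidable P] [Decidable Q] [Decidable R] :
    2 ≤ [decide P, decide Q, decide R].count true ↔ TwoOfThree P Q R := by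
  unfold TwoOfThree
  by_cases hP : P <;> by_cases hQ : Q <;> by_cases hR : R <;> simp [hP, hQ, hR]

/-! ### Majority of three as a truth-table reduction -/

/-- The query index is `1⁰ = ε`. [folklore] -/
def Idx0 : Language Bool := sndP ⁻¹' IsNil

/-- The query index has at most one symbol (so, if not `1⁰`, it is `1¹`). [folklore] -/
def Idx1 : Language Bool := (List.tail ∘ sndP) ⁻¹' IsNil

/-- Membership in `Idx0`: the second component is empty. [folklore] -/
theorem mem_Idx0_iff {z : List Bool} : z ∈ Idx0 ↔ sndP z = [] := Iff.rfl

/-- Membership in `Idx1`: the second component has at most one symbol. [folklore] -/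
theorem mem_Idx1_iff {z : List Bool} : z ∈ Idx1 ↔ (sndP z).tail = [] := Iff.rfl

/-- `Idx0 ∈ P`. [folklore] -/
theorem Idx0_mem_P : Idx0 ∈ Classes.P := preimage_mem_P IsNil_mem_P sndP_mem_FP

/-- `Idx1 ∈ P`. [folklore] -/
theorem Idx1_mem_P : Idx1 ∈ Classes.P := preimage_mem_P IsNil_mem_P (comp_mem_FP tail_mem_FP sndP_mem_FP)

/-- **The query generator of majority-of-three**: on `⟨w, 1ⁱ⟩` the `i`-th coin-block restriction of
`w = ⟨x, y₁ y₂ y₃⟩` — `⟨x, y₁⟩`, `⟨x, y₂⟩`, `⟨x, y₃⟩` for `i = 0, 1, 2` (blocks of length `p(|x|)`,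
`truncSndFn` / `dropSndFn` of `CoinTruncation.lean`). [cite: AroraBarakCC2009, Thm. 7.10 (proof: independent runs on disjoint coin blocks)] -/
def maj3Qry (p : Polynomial ℕ) : List Bool → List Bool :=
  condFn Idx0 (truncSndFn p ∘ fstP)
    (condFn Idx1 (truncSndFn p ∘ dropSndFn p ∘ fstP) (dropSndFn p ∘ dropSndFn p ∘ fstP))

/-- The query generator is polynomial-time. [folklore] -/
theorem maj3Qry_mem_FP (p : Polynomial ℕ) : maj3Qry p ∈ FP :=
  condFn_mem_FP Idx0_mem_P (comp_mem_FP (truncSndFn_mem_FP p) fstP_mem_FP)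
    (condFn_mem_FP Idx1_mem_P
      (comp_mem_FP (truncSndFn_mem_FP p) (comp_mem_FP (dropSndFn_mem_FP p) fstP_mem_FP))
      (comp_mem_FP (dropSndFn_mem_FP p) (comp_mem_FP (dropSndFn_mem_FP p) fstP_mem_FP)))

/-- Query `0`: the first block. [folklore] -/
theorem maj3Qry_zero (p : Polynomial ℕ) (w : List Bool) :
    maj3Qry p (boolPair w []) = truncSndFn p w := by
  rw [maj3Qry, condFn_of_mem _ _ (by rw [mem_Idx0_iff, sndP_boolPair])]
  simp

/-- Query `1`: the second block. [folklore] -/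
theorem maj3Qry_one (p : Polynomial ℕ) (w : List Bool) :
    maj3Qry p (boolPair w [true]) = truncSndFn p (dropSndFn p w) := by
  rw [maj3Qry, condFn_of_not_mem _ _ (by rw [mem_Idx0_iff, sndP_boolPair]; exact List.cons_ne_nil _ _),
    condFn_of_mem _ _ (by rw [mem_Idx1_iff, sndP_boolPair]; rfl)]
  simp

/-- Query `2`: the third block. [folklore] -/
theorem maj3Qry_two (p : Polynomial ℕ) (w : List Bool) :
    maj3Qry p (boolPair w [true, true]) = dropSndFn p (dropSndFn p w) := by
  rw [maj3Qry, condFn_of_not_mem _ _ (by rw [mem_Idx0_iff, sndP_boolPair]; exact List.cons_ne_nil _ _),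
    condFn_of_not_mem _ _ (by rw [mem_Idx1_iff, sndP_boolPair]; exact List.cons_ne_nil _ _)]
  simp

/-- **The evaluator of majority-of-three**: at least two of the three answer bits are `1`.
[cite: AroraBarakCC2009, Thm. 7.10 (proof: "if the majority of these outputs is 1, then output 1")] -/
def Maj3Dec : Language Bool := sndP ⁻¹' AtLeastTwoOnes

/-- The evaluator is in `P`. [folklore] -/
theorem Maj3Dec_mem_P : Maj3Dec ∈ Classes.P := preimage_mem_P AtLeastTwoOnes_mem_P sndP_mem_FP

/-- The three answer bits of the truth-table reduction. [folklore] -/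
theorem ttBits_maj3Qry (p : Polynomial ℕ) (L' : Language Bool) (w : List Bool) :
    ttBits (maj3Qry p) L' w 3 =
      [L'.boolIndicator (truncSndFn p w), L'.boolIndicator (truncSndFn p (dropSndFn p w)),
        L'.boolIndicator (dropSndFn p (dropSndFn p w))] := by
  simp [ttBits, List.range_succ, List.replicate, maj3Qry_zero, maj3Qry_one, maj3Qry_two]

/-- The indicator bit as a `decide`. [folklore] -/
theorem boolIndicator_eq_decide (L : Language Bool) (y : List Bool) [Decidable (y ∈ L)] :
    L.boolIndicator y = decide (y ∈ L) := by
  by_cases h : y ∈ L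
  · rw [(Set.mem_iff_boolIndicator _ _).1 h, decide_eq_true h]
  · rw [(Set.notMem_iff_boolIndicator _ _).1 h, decide_eq_false h]

/-- **Majority-of-three is a three-query truth-table reduction**:
`maj3Lang L' p = ttLang (maj3Qry p) 3 Maj3Dec L'`. [cite: AroraBarakCC2009, Thm. 7.10 (proof)] [cite: LadnerLynchSelman1975, §3] -/
theorem maj3Lang_eq_ttLang (L' : Language Bool) (p : Polynomial ℕ) :
    maj3Lang L' p = ttLang (maj3Qry p) 3 Maj3Dec L' := by
  classical
  ext w
  rw [mem_ttLang_iff, show (3 : Polynomial ℕ).eval w.length = 3 by simp, ttBits_maj3Qry]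
  change _ ↔ sndP (boolPair w [L'.boolIndicator (truncSndFn p w),
    L'.boolIndicator (truncSndFn p (dropSndFn p w)),
    L'.boolIndicator (dropSndFn p (dropSndFn p w))]) ∈ AtLeastTwoOnes
  rw [sndP_boolPair, mem_AtLeastTwoOnes, boolIndicator_eq_decide, boolIndicator_eq_decide,
    boolIndicator_eq_decide, two_le_count_iff]
  exact Iff.rfl

end Maj3Amp

open Maj3Amp

/-- **`P^A` is closed under majority-of-three**: for `L' ∈ P^A` and every block polynomial `p`,
`maj3Lang L' p ∈ P^A` — a truth-table reduction to `L'` (`ttLang_mem_PRel`) composed with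
`P^{P^A} = P^A` (`mem_PRel_of_polyTimeTuringReducible_holds`).
[cite: AroraBarakCC2009, Thm. 7.10 with §3.4 (the repetition argument relativizes)] [cite: BennettGill1981, §1] -/
theorem maj3Lang_mem_PRel {A L' : Language Bool} (hL' : L' ∈ PRel (Oracle.ofLanguage A))
    (p : Polynomial ℕ) : maj3Lang L' p ∈ PRel (Oracle.ofLanguage A) := by
  rw [maj3Lang_eq_ttLang]
  exact mem_PRel_of_polyTimeTuringReducible_holds
    (ttLang_mem_PRel (q := 3) (maj3Qry_mem_FP p) Maj3Dec_mem_P L') hL'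

/-! ### One round of majority-of-three over any class closed under `maj3Lang` -/

/-- **One round of error reduction over a class `C` closed under `maj3Lang`**:
`bpErr C e ⊆ bpErr C (e²(3 − 2e))` for `e ≤ 1` (witness `maj3Lang L' p`, coins `3p`; the count of
bad triples `uniformProb_badTriples_le`). [cite: AroraBarakCC2009, Thm. 7.10 (three independent runs)] -/
theorem mem_bpErr_maj3_of {C : Set (Language Bool)}
    (hC : ∀ L' ∈ C, ∀ p : Polynomial ℕ, maj3Lang L' p ∈ C) {L : Language Bool} {e : ℝ}
    (he : e ≤ 1) (hL : L ∈ bpErr C e) : L ∈ bpErr C (e ^ 2 * (3 - 2 * e)) := by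
  obtain ⟨L', hL', p, hp⟩ := hL
  refine ⟨maj3Lang L' p, hC L' hL' p, 3 * p, fun x => ?_⟩
  have h3 : (3 * p : Polynomial ℕ).eval x.length =
      p.eval x.length + (p.eval x.length + p.eval x.length) := by
    simp; ring
  rw [h3, setOf_not_maj3Lang_iff]
  exact uniformProb_badTriples_le (hp x) he

/-- `bpErr` is monotone in the error. [folklore] -/
theorem bpErr_mono (C : Set (Language Bool)) {e e' : ℝ} (h : e ≤ e') : bpErr C e ⊆ bpErr C e' := by
  rintro L ⟨L', hL', p, hp⟩
  exact ⟨L', hL', p, fun x => (hp x).trans h⟩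

/-- Error `≤ 1/3` is success `≥ 2/3`: `bpErr C e ⊆ bp C` for `e ≤ 1/3` (`uniformProb_compl`).
[cite: AroraBarakCC2009, Def. 7.2–7.3] -/
theorem bpErr_subset_bp {C : Set (Language Bool)} {e : ℝ} (he : e ≤ 1 / 3) : bpErr C e ⊆ bp C := by
  rintro L ⟨L', hL', p, hp⟩
  refine ⟨L', hL', p, fun x => ?_⟩
  have h := hp x
  rw [← Set.compl_setOf, uniformProb_compl] at h
  linarith

/-! ### Iterating: any error below one half -/

/-- **Geometric contraction below one half** for the one-round map `maj3Fn e = e²(3 − 2e)`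
(`ArthurMerlinParallelPlay.lean`): if `0 ≤ e ≤ 1/2 − d` then `e²(3 − 2e) ≤ (1 − d) e` (since
`3e − 2e² ≤ 1 − d` there: `1 − d − 3e + 2e² ≥ 2(e − 1/2)² ≥ 0`). [folklore] -/
theorem maj3Fn_le_mul {e d : ℝ} (he : 0 ≤ e) (hed : e ≤ 1 / 2 - d) : maj3Fn e ≤ (1 - d) * e := by
  unfold maj3Fn
  have h1 : 3 * e - 2 * e ^ 2 ≤ 1 - d := by nlinarith [sq_nonneg (e - 1 / 2)]
  nlinarith

/-- The one-round map is nonnegative below `1`: `e ≤ 1 ⟹ 0 ≤ e²(3 − 2e)`. [folklore] -/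
theorem maj3Fn_nonneg {e : ℝ} (he1 : e ≤ 1) : 0 ≤ maj3Fn e := by
  unfold maj3Fn
  have : 0 ≤ 3 - 2 * e := by linarith
  positivity

/-- Iterated error after `k` rounds stays in `[0, e]` and is at most `(1 − d)^k e` when
`0 ≤ e ≤ 1/2 − d`, `0 ≤ d`. [cite: AroraBarakCC2009, Thm. 7.10 (iterated)] -/
theorem maj3Fn_iterate_le {e d : ℝ} (he : 0 ≤ e) (hd : 0 ≤ d) (hed : e ≤ 1 / 2 - d) :
    ∀ k : ℕ, 0 ≤ maj3Fn^[k] e ∧ maj3Fn^[k] e ≤ (1 - d) ^ k * e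
  | 0 => ⟨by simpa using he, by simp⟩
  | k + 1 => by
    obtain ⟨h0, hk⟩ := maj3Fn_iterate_le he hd hed k
    have hpow : (1 - d) ^ k ≤ 1 := pow_le_one₀ (by linarith) (by linarith)
    have hke : maj3Fn^[k] e ≤ e := hk.trans (by nlinarith)
    rw [Function.iterate_succ_apply']
    refine ⟨maj3Fn_nonneg (by linarith), ?_⟩
    calc maj3Fn (maj3Fn^[k] e) ≤ (1 - d) * maj3Fn^[k] e := maj3Fn_le_mul h0 (by linarith)
      _ ≤ (1 - d) * ((1 - d) ^ k * e) := mul_le_mul_of_nonneg_left hk (by linarith)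
      _ = (1 - d) ^ (k + 1) * e := by ring

/-- `k` rounds over a class closed under `maj3Lang`: `bpErr C e ⊆ bpErr C (maj3Fn^[k] e)` for
`0 ≤ e ≤ 1/2`. [cite: AroraBarakCC2009, Thm. 7.10 (iterated)] -/
theorem bpErr_subset_bpErr_iterate {C : Set (Language Bool)}
    (hC : ∀ L' ∈ C, ∀ p : Polynomial ℕ, maj3Lang L' p ∈ C) {e : ℝ} (he : 0 ≤ e) (he2 : e ≤ 1 / 2) :
    ∀ k : ℕ, bpErr C e ⊆ bpErr C (maj3Fn^[k] e)
  | 0 => by simp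
  | k + 1 => by
    intro L hL
    rw [Function.iterate_succ_apply']
    have hk := (maj3Fn_iterate_le he le_rfl (by linarith) k)
    have hk1 : maj3Fn^[k] e ≤ 1 := by
      have := hk.2; rw [sub_zero, one_pow, one_mul] at this; linarith
    exact mem_bpErr_maj3_of hC hk1 (bpErr_subset_bpErr_iterate hC he he2 k hL)

/-- **Any error below one half amplifies to `2/3` success**: over a class `C` closed under
`maj3Lang`, `bpErr C e ⊆ bp C` for every `e < 1/2` (after `k` rounds the error is at most
`(1/2 + e)^k · e ≤ 1/3` for `k` large). "We can replace `2/3` with any constant larger than `1/2`."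
[cite: AroraBarakCC2009, §7.4.1 and Thm. 7.10] -/
theorem bpErr_subset_bp_of_lt_half {C : Set (Language Bool)}
    (hC : ∀ L' ∈ C, ∀ p : Polynomial ℕ, maj3Lang L' p ∈ C) {e : ℝ} (he : e < 1 / 2) :
    bpErr C e ⊆ bp C := by
  intro L hL
  by_cases hneg : e < 0
  · exact bpErr_subset_bp (by linarith) hL
  have he0 : 0 ≤ e := le_of_not_gt hneg
  set d : ℝ := 1 / 2 - e with hd
  have hd0 : 0 < d := by linarith
  obtain ⟨k, hk⟩ := exists_pow_lt_of_lt_one (show (0 : ℝ) < 2 / 3 by norm_num)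
    (show 1 - d < 1 by linarith)
  have hiter := maj3Fn_iterate_le he0 hd0.le (by linarith) k
  refine bpErr_subset_bp ?_ (bpErr_subset_bpErr_iterate hC he0 he.le k hL)
  calc maj3Fn^[k] e ≤ (1 - d) ^ k * e := hiter.2
    _ ≤ 2 / 3 * (1 / 2) := mul_le_mul hk.le he.le he0 (by norm_num)
    _ = 1 / 3 := by norm_num

/-- **`bpErr (P^A) e ⊆ BPP^A` for every `e < 1/2`**: bounded-error probabilistic polynomial time
relative to a language oracle tolerates any error bounded away from one half
(`maj3Lang_mem_PRel` feeds `bpErr_subset_bp_of_lt_half`).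
[cite: AroraBarakCC2009, §7.4.1 and Thm. 7.10] [cite: BennettGill1981, §1] -/
theorem bpErr_PRel_subset_BPPRel (A : Language Bool) {e : ℝ} (he : e < 1 / 2) :
    bpErr (PRel (Oracle.ofLanguage A)) e ⊆ BPPRel (Oracle.ofLanguage A) :=
  bpErr_subset_bp_of_lt_half (fun _ hL' p => maj3Lang_mem_PRel hL' p) he

/-- The unrelativized instance: `bpErr P e ⊆ BPP` for every `e < 1/2` (`maj3Lang_mem_P`).
[cite: AroraBarakCC2009, §7.4.1 and Thm. 7.10] -/
theorem bpErr_P_subset_BPP {e : ℝ} (he : e < 1 / 2) : bpErr Classes.P e ⊆ BPP :=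
  bpErr_subset_bp_of_lt_half (fun _ hL' p => maj3Lang_mem_P hL' p) he

end Literature.Computability.Complexity

end
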